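import Literature.MeasureTheory.Group.BruhatFunction
import Mathlib.MeasureTheory.Measure.Haar.Quotient
import Mathlib.Topology.UrysohnsLemma
import Mathlib.Topology.ContinuousMap.CompactlySupported
import Mathlib.Topology.Algebra.IsUniformGroup.Basic
import Mathlib.Analysis.Complex.Basic
import HarnessLib

/-!
# A compactly supported partition of unity for a cocompact discrete subgroup

Topic `MeasureTheory/Group`; namespace `Literature.MeasureTheory.Group.LatticePU`. For a discrete
subgroup `Λ` of a locally compact Hausdorff group `T` with `T ⧸ Λ` compact there is a COMPACTLY
SUPPORTED continuous `β : T → [0, ∞)` with `∑_{a ∈ Λ} β(t a) = 1` for every `t ∈ T`, i.e. a compactly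
supported Bruhat function of the cocompact discrete subgroup (Deitmar–Echterhoff, Lemma 1.5.1 with
`H = Λ`, counting measure and `g ≡ 1 ∈ C_c(T ⧸ Λ)`; Bourbaki, *Intégration* VII §2 no. 3–4). The tree's
`BruhatFunction` (`IsBruhatFunction`, `exists_isBruhatFunction`) treats a general closed subgroup of a
second countable group and does not record compact support; the cocompact discrete case proved here
needs no countability hypothesis and gives `β ∈ C_c(T, ℝ)` with the sum identity holding EVERYWHERE.

* `LatticePU.exists_isCompact_smul_cover` — a compact set meeting every right `Λ`-orbit (from the
  tree's `exists_isCompact_image_mk_superset`, Deitmar–Echterhoff Remark 1.5.2);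
* `LatticePU.exists_partitionOfUnity` — `∃ β : C_c(T, ℝ), (∀ t, 0 ≤ β t) ∧ ∀ t, ∑' a : Λ.op, β (a • t) = 1`
  (the right action `a • t = t * a` of `Λ.op`);
* `LatticePU.exists_partitionOfUnity_complex` — the same with the sum read in `ℂ`;
* `LatticePU.isBruhatFunction_count_of_sum_eq_one`, `LatticePU.exists_isBruhatFunction_count` — bridge
  to the tree's vocabulary: such a `β` IS a Bruhat function of `Λ` for the counting measure
  (`IsBruhatFunction Λ Measure.count β`, fibre integrals = orbit sums), so `BruhatFunction`'s quotient
  integration formulas apply to it.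

Construction: `g ∈ C_c(T, [0,1])` equal to `1` on the compact cover set (Urysohn),
`S(t) := ∑_{a ∈ Λ} g(t a)` — locally a finite sum by proper discontinuity of the right action of a
discrete subgroup, hence continuous, `Λ`-invariant and `≥ 1` — and `β := g / S`.

Provenance: HodgeCM PerL cell `pub-hodgecm`, package file `HodgeCM/Automorphic/LatticePartitionOfUnity.lean`
(seat pv15-g2, gate run 26; used there for the auxiliary `β ∈ C_c(T(𝔸))` of [PerL] v5 Prop. 3.6, l. 405),
ported to the tree under the LEAN-IN-TREE rule by seat pv15-g6 (names `HodgeCM.LatticePU.X` ↦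
`Literature.MeasureTheory.Group.LatticePU.X`, statements verbatim).

## References

* A. Deitmar, S. Echterhoff, *Principles of Harmonic Analysis*, 2nd ed. (2014), §1.5, Lemma 1.5.1 and
  Remark 1.5.2 [DeitmarEchterhoff2014].
* N. Bourbaki, *Intégration*, Ch. VII §2 no. 3–4 [folklore].
-/

noncomputable section

open Set Filter Function
open _root_.MeasureTheory _root_.Topology
open scoped CompactlySupported

namespace Literature.MeasureTheory.Group

namespace LatticePU

variable {T : Type*} [Group T] [TopologicalSpace T] [IsTopologicalGroup T] [LocallyCompactSpace T] [T2Space T]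
  (Λ : Subgroup T) [DiscreteTopology Λ] [CompactSpace (T ⧸ Λ)]

omit [T2Space T] [DiscreteTopology Λ] in
/-- If `T ⧸ Λ` is compact, some compact `K ⊆ T` meets every right `Λ`-orbit: `∀ t, ∃ a ∈ Λ, t a ∈ K`
(the tree's `exists_isCompact_image_mk_superset` applied to `C = univ`).
[cite: DeitmarEchterhoff2014, Remark 1.5.2] -/
theorem exists_isCompact_smul_cover : ∃ K : Set T, IsCompact K ∧ ∀ t : T, ∃ a : Λ.op, a • t ∈ K := by
  obtain ⟨K, hKc, hcov⟩ :=
    exists_isCompact_image_mk_superset (H := Λ) (isCompact_univ : IsCompact (univ : Set (T ⧸ Λ)))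
  refine ⟨K, hKc, fun t => ?_⟩
  obtain ⟨y, hy, hyt⟩ := hcov (mem_univ (QuotientGroup.mk t : T ⧸ Λ))
  rw [QuotientGroup.eq] at hyt
  refine ⟨⟨MulOpposite.op (y⁻¹ * t)⁻¹, Subgroup.mem_op.2 (Λ.inv_mem hyt)⟩, ?_⟩
  have : (⟨MulOpposite.op (y⁻¹ * t)⁻¹, Subgroup.mem_op.2 (Λ.inv_mem hyt)⟩ : Λ.op) • t = y := by
    rw [Subgroup.smul_def, Subgroup.coe_mk, MulOpposite.smul_eq_mul_unop, MulOpposite.unop_op, mul_inv_rev,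
      inv_inv, mul_inv_cancel_left]
  rw [this]
  exact hy

/-- **A compactly supported partition of unity for a cocompact discrete subgroup**: there is
`β ∈ C_c(T, ℝ)`, `β ≥ 0`, with `∑_{a ∈ Λ} β(t a) = 1` for every `t` (Deitmar–Echterhoff, Lemma 1.5.1:
`f ↦ f^H`, `C_c(G) → C_c(G ⧸ H)` is onto; here `H = Λ` discrete with counting measure and the target
is the constant `1` on the compact `T ⧸ Λ`). [cite: DeitmarEchterhoff2014, Lemma 1.5.1] -/
theorem exists_partitionOfUnity :
    ∃ β : C_c(T, ℝ), (∀ t, 0 ≤ β t) ∧ ∀ t : T, ∑' a : Λ.op, β (a • t) = 1 := by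
  classical
  -- proper discontinuity of the right action of the discrete subgroup `Λ`
  haveI : ProperlyDiscontinuousSMul Λ.op T :=
    Λ.properlyDiscontinuousSMul_opposite_of_tendsto_cofinite
      (Λ.tendsto_coe_cofinite_of_discrete (isDiscrete_iff_discreteTopology.2 inferInstance))
  have hsmul_cont : ∀ a : Λ.op, Continuous fun t : T => a • t := fun a => by
    simpa only [Subgroup.smul_def, MulOpposite.smul_eq_mul_unop] using
      (by fun_prop : Continuous fun t : T => t * MulOpposite.unop (a : Tᵐᵒᵖ))
  -- the compact cover set and a Urysohn function `g ∈ C_c(T, [0,1])`, `g = 1` on it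
  obtain ⟨K, hKc, hKcov⟩ := exists_isCompact_smul_cover Λ
  obtain ⟨g, hg1, -, hgc, hg01⟩ := exists_continuous_one_zero_of_isCompact hKc isClosed_empty (disjoint_empty K)
  have hg0 : ∀ x, 0 ≤ g x := fun x => (hg01 x).1
  -- local finiteness of `a ↦ g (a • t)`, locally uniformly in `t`
  have hloc : ∀ t₀ : T, ∃ N ∈ 𝓝 t₀, ∃ F : Finset Λ.op, ∀ t ∈ N, ∀ a : Λ.op, a ∉ F → g (a • t) = 0 := by
    intro t₀
    obtain ⟨N, hNc, hNn⟩ := exists_compact_mem_nhds t₀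
    have hfin := ProperlyDiscontinuousSMul.finite_disjoint_inter_image (Γ := Λ.op) hNc hgc.isCompact
    refine ⟨N, hNn, hfin.toFinset, fun t ht a ha => ?_⟩
    by_contra h
    apply ha
    rw [Set.Finite.mem_toFinset]
    exact ⟨a • t, ⟨t, ht, rfl⟩, subset_tsupport _ h⟩
  -- the Λ-periodisation `S` of `g`
  obtain ⟨S, hS⟩ : ∃ S : T → ℝ, S = fun t => ∑' a : Λ.op, g (a • t) := ⟨_, rfl⟩
  have hSsum : ∀ t₀ : T, ∃ N ∈ 𝓝 t₀, ∃ F : Finset Λ.op,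
      (∀ t ∈ N, ∀ a : Λ.op, a ∉ F → g (a • t) = 0) ∧ ∀ t ∈ N, S t = ∑ a ∈ F, g (a • t) := by
    intro t₀
    obtain ⟨N, hN, F, hF⟩ := hloc t₀
    exact ⟨N, hN, F, hF, fun t ht => by rw [hS]; exact tsum_eq_sum fun a ha => hF t ht a ha⟩
  have hScont : Continuous S := by
    refine continuous_iff_continuousAt.2 fun t₀ => ?_
    obtain ⟨N, hN, F, -, hF⟩ := hSsum t₀
    have hc : Continuous fun t : T => ∑ a ∈ F, g (a • t) :=
      continuous_finsetSum F fun a _ => g.continuous.comp (hsmul_cont a)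
    exact hc.continuousAt.congr (eventually_of_mem hN fun t ht => (hF t ht).symm)
  have hS1 : ∀ t, 1 ≤ S t := by
    intro t
    obtain ⟨N, hN, F, hF0, hF⟩ := hSsum t
    have ht : t ∈ N := mem_of_mem_nhds hN
    obtain ⟨a₀, ha₀⟩ := hKcov t
    have hga₀ : g (a₀ • t) = 1 := hg1 ha₀
    have ha₀F : a₀ ∈ F := by
      by_contra h
      have := hF0 t ht a₀ h
      rw [hga₀] at this
      exact one_ne_zero this
    rw [hF t ht, ← hga₀]
    exact Finset.single_le_sum (fun a _ => hg0 (a • t)) ha₀F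
  have hSpos : ∀ t, 0 < S t := fun t => one_pos.trans_le (hS1 t)
  have hSinv : ∀ (b : Λ.op) (t : T), S (b • t) = S t := by
    intro b t
    simp only [hS, smul_smul]
    exact (Equiv.mulRight b).tsum_eq fun a => g (a • t)
  -- `β := g / S`
  let βc : C(T, ℝ) := ⟨fun t => g t / S t, g.continuous.div hScont fun t => (hSpos t).ne'⟩
  have hβc : HasCompactSupport βc := by
    change HasCompactSupport fun t => g t / S t
    simp_rw [div_eq_mul_inv]
    exact hgc.mul_right
  refine ⟨⟨βc, hβc⟩, fun t => div_nonneg (hg0 t) (hSpos t).le, fun t => ?_⟩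
  change ∑' a : Λ.op, g (a • t) / S (a • t) = 1
  simp only [hSinv, tsum_div_const]
  have hSt : ∑' a : Λ.op, g (a • t) = S t := by rw [hS]
  rw [hSt]
  exact div_self (hSpos t).ne'

/-- The same partition of unity with the sum read in `ℂ`: `∑_{a ∈ Λ} (β(t a) : ℂ) = 1`.
[cite: DeitmarEchterhoff2014, Lemma 1.5.1] -/
theorem exists_partitionOfUnity_complex :
    ∃ β : C_c(T, ℝ), (∀ t, 0 ≤ β t) ∧ ∀ t : T, ∑' a : Λ.op, ((β (a • t) : ℝ) : ℂ) = 1 := by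
  obtain ⟨β, hβ0, hβ1⟩ := exists_partitionOfUnity Λ
  refine ⟨β, hβ0, fun t => ?_⟩
  rw [← Complex.ofReal_tsum, hβ1 t, Complex.ofReal_one]

omit [IsTopologicalGroup T] [LocallyCompactSpace T] [T2Space T] [DiscreteTopology Λ] [CompactSpace (T ⧸ Λ)] in
/-- **Bridge to `BruhatFunction`**: a continuous compactly supported `β ≥ 0` with `∑_{a ∈ Λ} β(t a) = 1`
everywhere is a Bruhat function of `Λ` for the counting measure — its fibre `a ↦ β(t a)` is summable
(the orbit sum is `1 ≠ 0`), hence `count`-integrable, and `∫_Λ β(t a) d(count) = ∑_{a ∈ Λ} β(t a) = 1`.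
[folklore] -/
theorem isBruhatFunction_count_of_sum_eq_one [MeasurableSpace Λ] [MeasurableSingletonClass Λ] [Countable Λ]
    (β : C_c(T, ℝ)) (hβ0 : ∀ t, 0 ≤ β t) (hβ1 : ∀ t : T, ∑' a : Λ.op, β (a • t) = 1) :
    IsBruhatFunction Λ Measure.count (β : T → ℝ) := by
  -- the fibre sum over `Λ` is the orbit sum over `Λ.op` (`Λ.equivOp a • t = t * a`)
  have hsum_eq : ∀ t : T, ∑' a : Λ, β (t * a) = ∑' a : Λ.op, β (a • t) := fun t => by
    rw [← (Λ.equivOp).tsum_eq]; rfl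
  have hsummable : ∀ t : T, Summable fun a : Λ => β (t * a) := fun t => by
    have h1 : Summable fun a : Λ.op => β (a • t) := by
      by_contra h
      have := tsum_eq_zero_of_not_summable h
      rw [hβ1 t] at this
      exact one_ne_zero this
    exact (Λ.equivOp.summable_iff.2 h1 : Summable fun a : Λ => β ((Λ.equivOp a) • t))
  have hint : ∀ g : T, Integrable (fun a : Λ => β (g * a)) Measure.count := fun g => by
    rw [integrable_count_iff]
    simpa only [Real.norm_of_nonneg (hβ0 _)] using hsummable g
  refine ⟨β.continuous, hβ0, hint, fun g => ?_⟩
  rw [integral_countable (hint g)]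
  simp only [Measure.real, Measure.count_singleton, ENNReal.toReal_one, one_smul]
  rw [hsum_eq, hβ1]

/-- **Compactly supported Bruhat functions of a cocompact discrete subgroup exist** (for the counting
measure on `Λ`): `exists_partitionOfUnity` read through `isBruhatFunction_count_of_sum_eq_one`.
[cite: DeitmarEchterhoff2014, Lemma 1.5.1] -/
theorem exists_isBruhatFunction_count [MeasurableSpace Λ] [MeasurableSingletonClass Λ] [Countable Λ] :
    ∃ β : C_c(T, ℝ), IsBruhatFunction Λ Measure.count (β : T → ℝ) ∧ ∀ t : T, ∑' a : Λ.op, β (a • t) = 1 := by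
  obtain ⟨β, hβ0, hβ1⟩ := exists_partitionOfUnity Λ
  exact ⟨β, isBruhatFunction_count_of_sum_eq_one Λ β hβ0 hβ1, hβ1⟩

end LatticePU

end Literature.MeasureTheory.Group

end
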